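import Summits.CriticalPhenomena.PercolationContinuityZ3.Theorems.SahiMasterFamilyStrictHarris
import Literature.Combinatorics.Sahi2008.SetPartitionForm
import Literature.Combinatorics.Sahi2008.Multilinear

/-!
# Lifting the master family by one independent coordinate (machinery for `MasterFamilyEqIff k → MasterFamilyNonneg k`)

Companion of `SahiMasterFamily.lean` (crux `NoHeavyLowerTail`, stmt-CriticalPhenomena-4575; cell `prim-l12`, unit
`prim-master-conj`).  Tools used by `SahiMasterFamilyEqImpliesNonneg.lean`:

* continuity of `μ ↦ E_n^μ(F)` (`continuous_sahiE`, induction along the Lieb–Sahi recursion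
  [LiebSahi2021, Prop. 3.3]) and of `p ↦ μ_p` (`continuous_bernoulliWeight`), hence `MasterFamilyNonneg k` follows
  from its OPEN-cube version (`masterFamilyNonneg_of_open`, shrinking `p` towards the centre);
* the LIFT `ι ↪ Option ι` with one new independent coordinate `none` of probability `t` (`liftP`), lifted functions
  `LG(ω') = 1[none ∈ ω']·G(ω' ∩ ι)` (`liftFun`) and events `LU = U ∧ [none open]` (`liftEvent`, increasing if `U`
  is); the basic identity `E_{μ_{(p,t)}}(LG) = t·E_{μ_p}(G)` (`ex_liftFun`);
* the small-`t` expansion `E_{n+1}^{μ_{(p,t)}}(LG) = t·n!·E_{μ_p}(∏_j G_j) + O(t²)` (`sahiE_lift_expansion`, from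
  the recursion) and the value at `t = 1`, `E_{n+1}^{μ_{(p,1)}}(LG) = E_{n+1}^{μ_p}(G)` (`sahiE_lift_one`, from Sahi's
  set-partition form [Sahi2008, eqs. (4)–(7)], `sahiE_eq_sahiESetPartition`).
Everything is proved; no named facts; axioms standard. [this work]
-/

noncomputable section

open scoped Classical

namespace Summit.CriticalPhenomena.PercolationContinuityZ3.Theorems

open Finset Function MeasureTheory Filter Topology
open Literature.Combinatorics.Sahi2008
open Literature.Probability.Percolation (DeterminedBy)
open Literature.Probability.Percolation.DecisionTree (ind ind_of_mem ind_of_not_mem ind_nonneg)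

/-! ### Continuity of `E_n` in the weight and of the product weight in `p` -/

section Continuity

variable {α : Type*} [Fintype α]

/-- `μ ↦ E_μ(f)` is continuous (a finite sum). [folklore] -/
theorem continuous_ex (f : α → ℝ) : Continuous fun μ : α → ℝ => ex μ f := by
  simp only [ex]
  exact continuous_finsetSum _ fun x _ => (continuous_apply x).mul continuous_const

/-- `μ ↦ E_n^μ(F)` is continuous for every family `F` (induction along the Lieb–Sahi recursion). [this work] -/
theorem continuous_sahiE : ∀ (n : ℕ) (F : Fin n → α → ℝ), Continuous fun μ : α → ℝ => sahiE μ n F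
  | 0, F => by simp only [sahiE_zero]; exact continuous_const
  | 1, F => by simp only [sahiE_one_apply]; exact continuous_ex (F 0)
  | n + 2, F => by
    simp only [sahiE_succ_succ]
    exact (continuous_finsetSum _ fun i _ => continuous_sahiE (n + 1) _).sub
      ((continuous_sahiE (n + 1) _).mul (continuous_ex _))

end Continuity

section WeightContinuity

variable {ι : Type*} [Fintype ι]

/-- `p ↦ μ_p` (the product weight, a point of `Set ι → ℝ`) is continuous on `[0,1]^ι`. [folklore] -/
theorem continuous_bernoulliWeight : Continuous fun p : ι → unitInterval => bernoulliWeight p := by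
  refine continuous_pi fun ω => ?_
  simp only [bernoulliWeight, Literature.Probability.Percolation.BHK2006.weight]
  refine continuous_finsetProd _ fun e _ => ?_
  by_cases he : e ∈ ω
  · simp only [he, if_true]
    exact continuous_subtype_val.comp (continuous_apply e)
  · simp only [he, if_false]
    exact continuous_const.sub (continuous_subtype_val.comp (continuous_apply e))

/-- `p ↦ E_k(μ_p; F)` is continuous on `[0,1]^ι`. [this work] -/
theorem continuous_sahiE_bernoulliWeight (k : ℕ) (F : Fin k → Set ι → ℝ) :
    Continuous fun p : ι → unitInterval => sahiE (bernoulliWeight p) k F :=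
  (continuous_sahiE k F).comp continuous_bernoulliWeight

end WeightContinuity

/-! ### From the open cube to the closed cube -/

section Density

variable {ι : Type*} [Fintype ι]

/-- Shrinking `p ∈ [0,1]^ι` towards the centre: `p^{(m)}_e = (1 − ε_m) p_e + ε_m/2`, `ε_m = 1/(m+1)`, lies in the OPEN cube
and tends to `p`. [folklore] -/
def shrink (p : ι → unitInterval) (m : ℕ) : ι → unitInterval := fun e =>
  ⟨(1 - 1 / ((m : ℝ) + 1)) * (p e : ℝ) + 1 / ((m : ℝ) + 1) / 2, by
    have h0 : (0 : ℝ) ≤ p e := (p e).2.1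
    have h1 : (p e : ℝ) ≤ 1 := (p e).2.2
    have hε0 : (0 : ℝ) < 1 / ((m : ℝ) + 1) := by positivity
    have hε1 : 1 / ((m : ℝ) + 1) ≤ 1 := by
      rw [div_le_one (by positivity)]; linarith [(Nat.cast_nonneg m : (0 : ℝ) ≤ m)]
    constructor <;> nlinarith⟩

omit [Fintype ι] in
/-- The shrunk parameters lie in the open cube. [folklore] -/
theorem shrink_mem_Ioo (p : ι → unitInterval) (m : ℕ) (e : ι) : (shrink p m e : ℝ) ∈ Set.Ioo (0 : ℝ) 1 := by
  have h0 : (0 : ℝ) ≤ p e := (p e).2.1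
  have h1 : (p e : ℝ) ≤ 1 := (p e).2.2
  have hε0 : (0 : ℝ) < 1 / ((m : ℝ) + 1) := by positivity
  have hε1 : 1 / ((m : ℝ) + 1) ≤ 1 := by
    rw [div_le_one (by positivity)]; linarith [(Nat.cast_nonneg m : (0 : ℝ) ≤ m)]
  simp only [shrink, Set.mem_Ioo]
  constructor <;> nlinarith

omit [Fintype ι] in
/-- The shrunk parameters converge to `p`. [folklore] -/
theorem tendsto_shrink (p : ι → unitInterval) : Tendsto (shrink p) atTop (𝓝 p) := by
  rw [tendsto_pi_nhds]
  intro e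
  rw [tendsto_subtype_rng]
  simp only [shrink]
  have hε : Tendsto (fun m : ℕ => 1 / ((m : ℝ) + 1)) atTop (𝓝 0) := tendsto_one_div_add_atTop_nhds_zero_nat
  have : Tendsto (fun m : ℕ => (1 - 1 / ((m : ℝ) + 1)) * (p e : ℝ) + 1 / ((m : ℝ) + 1) / 2) atTop
      (𝓝 ((1 - 0) * (p e : ℝ) + 0 / 2)) :=
    ((tendsto_const_nhds.sub hε).mul tendsto_const_nhds).add (hε.div_const 2)
  simpa using this

/-- **Open cube suffices.** If `E_k(μ_p; 1_U) ≥ 0` for every `p` in the OPEN cube (and every finite `ι`, every `k`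
increasing events), then `MasterFamilyNonneg k` (all `p ∈ [0,1]^ι`), by continuity of `p ↦ E_k(μ_p; 1_U)`. [this work] -/
theorem masterFamilyNonneg_of_open (k : ℕ)
    (h : ∀ (ι : Type) [Fintype ι] (p : ι → unitInterval), (∀ e, (p e : ℝ) ∈ Set.Ioo (0 : ℝ) 1) →
      ∀ U : Fin k → Set (Set ι), (∀ j, IsUpperSet (U j)) → 0 ≤ sahiE (bernoulliWeight p) k (fun j => ind (U j))) :
    MasterFamilyNonneg k := by
  intro ι _ p U hU
  have hc := (continuous_sahiE_bernoulliWeight k (fun j => ind (U j))).continuousAt.tendsto.comp (tendsto_shrink p)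
  exact ge_of_tendsto' hc fun m => h ι (shrink p m) (shrink_mem_Ioo p m) U hU

end Density

/-! ### Lifting to one more independent coordinate: `ι ↪ Option ι`, the new coordinate `none` has probability `t` -/

section Lift

variable {ι : Type*} [Fintype ι]

/-- The parameter vector on `Option ι`: `none ↦ t`, `some e ↦ p_e`. [this work] -/
def liftP (p : ι → unitInterval) (t : unitInterval) : Option ι → unitInterval := fun i => i.elim t p

/-- The indicator of "the new coordinate is open". [this work] -/
def newOpen (ω' : Set (Option ι)) : ℝ := if none ∈ ω' then 1 else 0

omit [Fintype ι] in
/-- `1[none open]` is idempotent. [folklore] -/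
theorem newOpen_mul_self (ω' : Set (Option ι)) : newOpen ω' * newOpen ω' = newOpen ω' := by
  unfold newOpen; split_ifs <;> simp

/-- Lift of a function on `Set ι`: `(LG)(ω') = 1[none ∈ ω'] · G(ω' ∩ ι)`. [this work] -/
def liftFun (G : Set ι → ℝ) : Set (Option ι) → ℝ := fun ω' => newOpen ω' * G (some ⁻¹' ω')

/-- Lift of an event: `LU = {ω' : none ∈ ω' ∧ ω' ∩ ι ∈ U}` (`= U ∧ [none open]`). [this work] -/
def liftEvent (U : Set (Set ι)) : Set (Set (Option ι)) := {ω' | none ∈ ω' ∧ some ⁻¹' ω' ∈ U}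

omit [Fintype ι] in
/-- The lift of an increasing event is increasing. [this work] -/
theorem isUpperSet_liftEvent {U : Set (Set ι)} (hU : IsUpperSet U) : IsUpperSet (liftEvent U) := by
  intro a b hab ha
  exact ⟨hab ha.1, hU (Set.preimage_mono hab) ha.2⟩

omit [Fintype ι] in
/-- The indicator of a lifted event is the lifted indicator. [this work] -/
theorem ind_liftEvent (U : Set (Set ι)) : ind (liftEvent U) = liftFun (ind U) := by
  funext ω'
  simp only [liftFun, newOpen, liftEvent]
  by_cases h : none ∈ ω'
  · by_cases hU : some ⁻¹' ω' ∈ U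
    · rw [ind_of_mem (show ω' ∈ {ω' | none ∈ ω' ∧ some ⁻¹' ω' ∈ U} from ⟨h, hU⟩), if_pos h, ind_of_mem hU, one_mul]
    · rw [ind_of_not_mem (show ω' ∉ {ω' | none ∈ ω' ∧ some ⁻¹' ω' ∈ U} from fun h' => hU h'.2), if_pos h,
        ind_of_not_mem hU, one_mul]
  · rw [ind_of_not_mem (show ω' ∉ {ω' | none ∈ ω' ∧ some ⁻¹' ω' ∈ U} from fun h' => h h'.1), if_neg h, zero_mul]

omit [Fintype ι] in
/-- Lifting commutes with products: `L(G)·L(H) = L(G·H)`. [this work] -/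
theorem liftFun_mul (G H : Set ι → ℝ) : liftFun G * liftFun H = liftFun (G * H) := by
  funext ω'
  simp only [liftFun, Pi.mul_apply]
  rw [show newOpen ω' * G (some ⁻¹' ω') * (newOpen ω' * H (some ⁻¹' ω')) =
      newOpen ω' * newOpen ω' * (G (some ⁻¹' ω') * H (some ⁻¹' ω')) by ring, newOpen_mul_self]

omit [Fintype ι] in
/-- Lifting commutes with nonempty finite products. [this work] -/
theorem prod_liftFun {m : ℕ} (hm : 0 < m) (G : Fin m → Set ι → ℝ) :
    ∏ r, liftFun (G r) = liftFun (∏ r, G r) := by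
  induction m with
  | zero => exact absurd hm (lt_irrefl 0)
  | succ m ih =>
    rw [Fin.prod_univ_succ, Fin.prod_univ_succ]
    rcases Nat.eq_zero_or_pos m with h0 | hpos
    · subst h0
      simp
    · rw [ih hpos (fun r => G r.succ), liftFun_mul]

/-- The weight of `insert none ω'` under the lifted parameters is `t · μ_p(ω' ∩ ι)`. [this work] -/
theorem bernoulliWeight_liftP_insert (p : ι → unitInterval) (t : unitInterval) (ω' : Set (Option ι)) :
    bernoulliWeight (liftP p t) (insert none ω') = (t : ℝ) * bernoulliWeight p (some ⁻¹' ω') := by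
  simp only [bernoulliWeight, Literature.Probability.Percolation.BHK2006.weight]
  rw [Fintype.prod_option]
  simp only [liftP, Option.elim, Set.mem_insert_iff, true_or, if_true]
  congr 1
  refine prod_congr rfl fun e _ => ?_
  simp only [reduceCtorEq, false_or, Set.mem_preimage]

/-- **Lifted expectation**: `E_{μ'}(L G) = t · E_μ(G)` for the lifted product weight `μ' = μ_{(p,t)}` on `Set (Option ι)`.
[this work] -/
theorem ex_liftFun (p : ι → unitInterval) (t : unitInterval) (G : Set ι → ℝ) :
    ex (bernoulliWeight (liftP p t)) (liftFun G) = (t : ℝ) * ex (bernoulliWeight p) G := by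
  simp only [ex]
  rw [sum_conf_split none, mul_sum]
  have hval : ∀ ω' ∈ univ.filter (fun ω' : Set (Option ι) => none ∉ ω'),
      bernoulliWeight (liftP p t) ω' * liftFun G ω' +
          bernoulliWeight (liftP p t) (insert none ω') * liftFun G (insert none ω') =
        (t : ℝ) * (bernoulliWeight p (some ⁻¹' ω') * G (some ⁻¹' ω')) := by
    intro ω' hω'
    simp only [mem_filter, mem_univ, true_and] at hω'
    have h1 : liftFun G ω' = 0 := by simp [liftFun, newOpen, hω']
    have h2 : liftFun G (insert none ω') = G (some ⁻¹' ω') := by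
      simp only [liftFun, newOpen, Set.mem_insert_iff, true_or, if_true, one_mul]
      congr 1
      ext e; simp
    rw [h1, mul_zero, zero_add, h2, bernoulliWeight_liftP_insert]
    ring
  rw [sum_congr rfl hval]
  refine sum_nbij' (fun ω' => some ⁻¹' ω') (fun ω => some '' ω) ?_ ?_ ?_ ?_ ?_
  · intro ω' _; exact mem_univ _
  · intro ω _
    simp only [mem_filter, mem_univ, true_and, Set.mem_image, not_exists, not_and]
    exact fun e _ h => Option.some_ne_none e h
  · intro ω' hω'
    simp only [mem_filter, mem_univ, true_and] at hω'
    ext x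
    simp only [Set.mem_image, Set.mem_preimage]
    constructor
    · rintro ⟨e, he, rfl⟩; exact he
    · intro hx
      cases x with
      | none => exact absurd hx hω'
      | some e => exact ⟨e, hx, rfl⟩
  · intro ω _
    exact Set.preimage_image_eq ω (Option.some_injective ι)
  · intro ω' _; rfl

end Lift

/-! ### The lifted family: small-`t` expansion and the value at `t = 1` -/

section Scaling

variable {ι : Type*} [Fintype ι]

omit [Fintype ι] in
/-- `t ↦ (p, t)` is continuous. [folklore] -/
theorem continuous_liftP (p : ι → unitInterval) : Continuous (liftP p) := by
  refine continuous_pi fun i => ?_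
  cases i with
  | none => exact continuous_id
  | some e => exact continuous_const

omit [Fintype ι] in
/-- Updating a lifted family by a lifted product is the lift of the updated family. [this work] -/
theorem update_liftFun {n : ℕ} (G : Fin n → Set ι → ℝ) (i : Fin n) (H : Set ι → ℝ) :
    update (fun j => liftFun (G j)) i ((fun j => liftFun (G j)) i * liftFun H) =
      fun j => liftFun (update G i (G i * H) j) := by
  funext j
  by_cases hj : j = i
  · subst hj; simp only [update_self, liftFun_mul]
  · simp only [update_of_ne hj]

omit [Fintype ι] in
/-- The product of a family updated by absorbing the head is the full product (plumbing). [folklore] -/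
theorem prod_update_tail_mul_head {n : ℕ} (G : Fin (n + 2) → Set ι → ℝ) (i : Fin (n + 1)) :
    ∏ j, update (Fin.tail G) i (Fin.tail G i * G 0) j = ∏ j, G j := by
  rw [prod_update_of_mem (mem_univ i), sdiff_singleton_eq_erase, Fin.prod_univ_succ,
    show (∏ j : Fin (n + 1), G j.succ) = ∏ j, Fin.tail G j from rfl, ← mul_prod_erase univ (Fin.tail G) (mem_univ i)]
  ring

/-- **Small-`t` expansion of the lifted functional**: for the lift `LG = (1[none open]·G_j)_j` of a family of
`n + 1` functions and the lifted weight `μ' = μ_{(p,t)}`,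
`E_{n+1}^{μ'}(LG) = t · n! · E_μ(∏_j G_j) + O(t²)` uniformly in `t ∈ [0,1]` (induction along the Lieb–Sahi
recursion, using `E_{μ'}(L H) = t·E_μ(H)`). [this work] -/
theorem sahiE_lift_expansion (p : ι → unitInterval) :
    ∀ (n : ℕ) (G : Fin (n + 1) → Set ι → ℝ), ∃ M : ℝ, ∀ t : unitInterval,
      |sahiE (bernoulliWeight (liftP p t)) (n + 1) (fun j => liftFun (G j)) -
          (t : ℝ) * (n.factorial : ℝ) * ex (bernoulliWeight p) (∏ j, G j)| ≤ M * (t : ℝ) ^ 2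
  | 0, G => ⟨0, fun t => by
      rw [sahiE_one_apply, ex_liftFun]
      simp⟩
  | n + 1, G => by
    have IH := fun i : Fin (n + 1) => sahiE_lift_expansion p n (update (Fin.tail G) i (Fin.tail G i * G 0))
    choose M hM using IH
    obtain ⟨M', hM'⟩ := sahiE_lift_expansion p n (Fin.tail G)
    set e₀ := ex (bernoulliWeight p) (G 0) with he₀
    set P' := ex (bernoulliWeight p) (∏ j, Fin.tail G j) with hP'
    set X := ex (bernoulliWeight p) (∏ j, G j) with hX
    refine ⟨∑ i, M i + |e₀| * M' + |(n.factorial : ℝ) * P' * e₀|, fun t => ?_⟩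
    rw [sahiE_succ_succ]
    have htail : Fin.tail (fun j => liftFun (G j)) = fun j => liftFun (Fin.tail G j) := rfl
    rw [htail, ex_liftFun]
    simp only [update_liftFun]
    -- the remainders
    have hR : ∀ i : Fin (n + 1),
        |sahiE (bernoulliWeight (liftP p t)) (n + 1)
            (fun j => liftFun (update (Fin.tail G) i (Fin.tail G i * G 0) j)) -
          (t : ℝ) * (n.factorial : ℝ) * X| ≤ M i * (t : ℝ) ^ 2 := by
      intro i
      have := hM i t
      rwa [prod_update_tail_mul_head G i] at this
    have hR' := hM' t
    have ht0 : (0 : ℝ) ≤ t := t.2.1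
    have ht1 : (t : ℝ) ≤ 1 := t.2.2
    -- regroup
    have key : (∑ i : Fin (n + 1), sahiE (bernoulliWeight (liftP p t)) (n + 1)
          (fun j => liftFun (update (Fin.tail G) i (Fin.tail G i * G 0) j))) -
          sahiE (bernoulliWeight (liftP p t)) (n + 1) (fun j => liftFun (Fin.tail G j)) * ((t : ℝ) * e₀) -
          (t : ℝ) * ((n + 1).factorial : ℝ) * X =
        (∑ i : Fin (n + 1), (sahiE (bernoulliWeight (liftP p t)) (n + 1)
          (fun j => liftFun (update (Fin.tail G) i (Fin.tail G i * G 0) j)) - (t : ℝ) * (n.factorial : ℝ) * X)) -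
          ((t : ℝ) * e₀) * (sahiE (bernoulliWeight (liftP p t)) (n + 1) (fun j => liftFun (Fin.tail G j)) -
            (t : ℝ) * (n.factorial : ℝ) * P') -
          (t : ℝ) ^ 2 * ((n.factorial : ℝ) * P' * e₀) := by
      rw [sum_sub_distrib, sum_const, card_univ, Fintype.card_fin, Nat.factorial_succ]
      push_cast
      simp only [nsmul_eq_mul]
      push_cast
      ring
    rw [key]
    have h1 : |∑ i : Fin (n + 1), (sahiE (bernoulliWeight (liftP p t)) (n + 1)
          (fun j => liftFun (update (Fin.tail G) i (Fin.tail G i * G 0) j)) - (t : ℝ) * (n.factorial : ℝ) * X)| ≤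
        (∑ i, M i) * (t : ℝ) ^ 2 := by
      rw [sum_mul]
      exact (abs_sum_le_sum_abs _ _).trans (sum_le_sum fun i _ => hR i)
    have h2 : |((t : ℝ) * e₀) * (sahiE (bernoulliWeight (liftP p t)) (n + 1) (fun j => liftFun (Fin.tail G j)) -
            (t : ℝ) * (n.factorial : ℝ) * P')| ≤ |e₀| * M' * (t : ℝ) ^ 2 := by
      rw [abs_mul, abs_mul, abs_of_nonneg ht0]
      have hM'nn : 0 ≤ M' * (t : ℝ) ^ 2 := (abs_nonneg _).trans hR'
      calc (t : ℝ) * |e₀| * |sahiE (bernoulliWeight (liftP p t)) (n + 1) (fun j => liftFun (Fin.tail G j)) -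
              (t : ℝ) * (n.factorial : ℝ) * P'|
          ≤ 1 * |e₀| * (M' * (t : ℝ) ^ 2) := by
            gcongr
          _ = |e₀| * M' * (t : ℝ) ^ 2 := by ring
    have h3 : |(t : ℝ) ^ 2 * ((n.factorial : ℝ) * P' * e₀)| = |(n.factorial : ℝ) * P' * e₀| * (t : ℝ) ^ 2 := by
      rw [abs_mul, abs_of_nonneg (by positivity)]; ring
    calc _ ≤ |∑ i : Fin (n + 1), (sahiE (bernoulliWeight (liftP p t)) (n + 1)
              (fun j => liftFun (update (Fin.tail G) i (Fin.tail G i * G 0) j)) - (t : ℝ) * (n.factorial : ℝ) * X)| +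
            |((t : ℝ) * e₀) * (sahiE (bernoulliWeight (liftP p t)) (n + 1) (fun j => liftFun (Fin.tail G j)) -
              (t : ℝ) * (n.factorial : ℝ) * P')| +
            |(t : ℝ) ^ 2 * ((n.factorial : ℝ) * P' * e₀)| :=
            (abs_sub _ _).trans (by gcongr; exact abs_sub _ _)
      _ ≤ (∑ i, M i) * (t : ℝ) ^ 2 + |e₀| * M' * (t : ℝ) ^ 2 + |(n.factorial : ℝ) * P' * e₀| * (t : ℝ) ^ 2 := by
            rw [h3]; gcongr
      _ = _ := by ring

/-- **The lift at `t = 1` is the original functional**: `E_{n+1}^{μ_{(p,1)}}(LG) = E_{n+1}^{μ_p}(G)` (both are the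
same signed sum over set partitions of the same block moments, `E_{μ'}(L H) = 1·E_μ(H)`). [this work] -/
theorem sahiE_lift_one (p : ι → unitInterval) (n : ℕ) (G : Fin (n + 1) → Set ι → ℝ) (t : unitInterval)
    (ht : (t : ℝ) = 1) :
    sahiE (bernoulliWeight (liftP p t)) (n + 1) (fun j => liftFun (G j)) = sahiE (bernoulliWeight p) (n + 1) G := by
  rw [sahiE_eq_sahiESetPartition, sahiE_eq_sahiESetPartition]
  unfold sahiESetPartition
  refine sum_congr rfl fun c _ => ?_
  congr 1
  refine prod_congr rfl fun m _ => ?_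
  congr 1
  rw [prod_liftFun (c.partSize_pos m), ex_liftFun, ht, one_mul]

end Scaling

end Summit.CriticalPhenomena.PercolationContinuityZ3.Theorems
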